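import Mathlib
import Summits.HodgeConjecture.HodgeConjecture.Theorems.TropicalKugaSatakeCayleyCayleyHodgeRankTwoCuspForms
import Summits.HodgeConjecture.HodgeConjecture.Theorems.TropicalKugaSatakeCayleyCayleyHodgeRankTwoCuspMatrices
import Summits.HodgeConjecture.HodgeConjecture.Theorems.TropicalKugaSatakeCayleyCayleyHodgeRankTwoSlotLeibniz
import Summits.HodgeConjecture.HodgeConjecture.Theorems.TropicalKugaSatakeCayleyCayleyHodgeRankTwoFlatCertificate

/-!
# Route `TropicalKugaSatakeCayley`, support S5 `CayleyHodgeRankTwo` (stmt-HodgeConjecture-18573) — part B8a: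
# kernel-checked flatness certificates — the `θ²`-table along the five raising operators

For each listed cusp operator `N` (part B6) and the table `κ` (part B3) this file proves
`∀ u, Σₘ κ(u₀, …, N uₘ, …, u₃) = 0` — the slotwise derivation of `κ` along `N` vanishes identically —
by the pipeline of parts B4–B6: `tkc_slotSum_table_cols` expands the derivation into the explicit integral
combination `Σ_{t,j,s} (coef t · val_s) • θ_{word t [j ↦ col_s]}` of monomials of modified words, and
`tkc_cert_sum_eq_zero` kills it given a CERTIFICATE (reference words `Ω`, tags `none | some (group,
adjacent swaps)`) whose three finite hypotheses are checked by `decide` in the kernel. The certificates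
were produced by exact integer linear algebra (the common kernel of the ten derivations on `Λ^{2,2}`
has dimension `6 = 1 + 5`, van Geemen–Verra Cor. 6.5) and are merely verified here. Theorems only:
no definition, no named fact, no sorry; `decide` uses kernel reduction only (no `native_decide`).

## References

* [vanGeemenVerra2003QuaternionicPryms] B. van Geemen, A. Verra, Quaternionic Pryms and Hodge classes,
  Topology 42 (2003), §6.1, Cor. 6.5, Lemma 6.8.
-/

noncomputable section

set_option linter.dupNamespace false

namespace Summit.HodgeConjecture.HodgeConjecture.Theorems

open Literature.LinearAlgebra.Alternating

/-- **The `θ²`-table `tkcTheta22` is flat along the raising operator `N_0 = tkcRaise (ksForm 0)`** (certificate: 0 reference words,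
0 live terms; kernel-checked). [cite: vanGeemenVerra2003QuaternionicPryms, Cor. 6.5] -/
theorem tkc_flat_theta_raise_0 (u : Fin 4 → (Fin 8 ⊕ Fin 8 → ℝ)) :
    ∑ m, tkcTheta22 (Function.update u m (tkcRaise (tkcRaiseMat 0) (u m))) = 0 := by
  rw [tkcTheta22_eq, tkcTable_eq,
    tkc_slotSum_table_cols tkcFrame tkcVec tkc_sum_smulRight_frame_vec (tkcRaise (tkcRaiseMat 0))
      tkcThetaWord (fun _ => 1) (tkcRaiseCol 0) (tkcRaiseVal 0) (tkc_raise_frame_vec_eq 0) u]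
  have h0 := tkc_cert_sum_eq_zero (𝕜 := ℝ) (fun a => (tkcFrame a).smulRight (1 : ℂ))
    (ContinuousAlternatingMap.constOfIsEmpty ℝ (Fin 8 ⊕ Fin 8 → ℝ) (Fin 0) (1 : ℂ))
    (fun t j s => (fun _ : Fin 28 => (1 : ℤ)) t * tkcRaiseVal 0 s (tkcThetaWord t j))
    (fun t j s => Function.update (tkcThetaWord t) j (tkcRaiseCol 0 s (tkcThetaWord t j)))
    ((![]) : Fin 0 → (Fin 4 → Fin 16))
    ((fun _ _ _ => none) : Fin 28 → Fin 4 → Fin 2 → Option (Fin 0 × List (Fin 3)))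
    (by decide +kernel) (by decide +kernel) (by decide +kernel)
  exact (congrArg (fun f : (Fin 8 ⊕ Fin 8 → ℝ) [⋀^Fin 4]→L[ℝ] ℂ => f u) h0).trans rfl

/-- **The `θ²`-table `tkcTheta22` is flat along the raising operator `N_1 = tkcRaise (ksForm 1)`** (certificate: 0 reference words,
0 live terms; kernel-checked). [cite: vanGeemenVerra2003QuaternionicPryms, Cor. 6.5] -/
theorem tkc_flat_theta_raise_1 (u : Fin 4 → (Fin 8 ⊕ Fin 8 → ℝ)) :
    ∑ m, tkcTheta22 (Function.update u m (tkcRaise (tkcRaiseMat 1) (u m))) = 0 := by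
  rw [tkcTheta22_eq, tkcTable_eq,
    tkc_slotSum_table_cols tkcFrame tkcVec tkc_sum_smulRight_frame_vec (tkcRaise (tkcRaiseMat 1))
      tkcThetaWord (fun _ => 1) (tkcRaiseCol 1) (tkcRaiseVal 1) (tkc_raise_frame_vec_eq 1) u]
  have h0 := tkc_cert_sum_eq_zero (𝕜 := ℝ) (fun a => (tkcFrame a).smulRight (1 : ℂ))
    (ContinuousAlternatingMap.constOfIsEmpty ℝ (Fin 8 ⊕ Fin 8 → ℝ) (Fin 0) (1 : ℂ))
    (fun t j s => (fun _ : Fin 28 => (1 : ℤ)) t * tkcRaiseVal 1 s (tkcThetaWord t j))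
    (fun t j s => Function.update (tkcThetaWord t) j (tkcRaiseCol 1 s (tkcThetaWord t j)))
    ((![]) : Fin 0 → (Fin 4 → Fin 16))
    ((fun _ _ _ => none) : Fin 28 → Fin 4 → Fin 2 → Option (Fin 0 × List (Fin 3)))
    (by decide +kernel) (by decide +kernel) (by decide +kernel)
  exact (congrArg (fun f : (Fin 8 ⊕ Fin 8 → ℝ) [⋀^Fin 4]→L[ℝ] ℂ => f u) h0).trans rfl

/-- **The `θ²`-table `tkcTheta22` is flat along the raising operator `N_2 = tkcRaise (ksForm 2)`** (certificate: 24 reference words,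
48 live terms; kernel-checked). [cite: vanGeemenVerra2003QuaternionicPryms, Cor. 6.5] -/
theorem tkc_flat_theta_raise_2 (u : Fin 4 → (Fin 8 ⊕ Fin 8 → ℝ)) :
    ∑ m, tkcTheta22 (Function.update u m (tkcRaise (tkcRaiseMat 2) (u m))) = 0 := by
  rw [tkcTheta22_eq, tkcTable_eq,
    tkc_slotSum_table_cols tkcFrame tkcVec tkc_sum_smulRight_frame_vec (tkcRaise (tkcRaiseMat 2))
      tkcThetaWord (fun _ => 1) (tkcRaiseCol 2) (tkcRaiseVal 2) (tkc_raise_frame_vec_eq 2) u]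
  have h0 := tkc_cert_sum_eq_zero (𝕜 := ℝ) (fun a => (tkcFrame a).smulRight (1 : ℂ))
    (ContinuousAlternatingMap.constOfIsEmpty ℝ (Fin 8 ⊕ Fin 8 → ℝ) (Fin 0) (1 : ℂ))
    (fun t j s => (fun _ : Fin 28 => (1 : ℤ)) t * tkcRaiseVal 2 s (tkcThetaWord t j))
    (fun t j s => Function.update (tkcThetaWord t) j (tkcRaiseCol 2 s (tkcThetaWord t j)))
    ((![
      ![2, 8, 9, 10], ![0, 8, 10, 11], ![3, 8, 9, 11], ![4, 8, 9, 12], ![0, 8, 12, 13], ![5, 8, 9, 13],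
      ![6, 8, 9, 14], ![0, 8, 14, 15], ![7, 8, 9, 15], ![1, 9, 10, 11], ![1, 9, 12, 13], ![1, 9, 14, 15],
      ![4, 10, 11, 12], ![2, 10, 12, 13], ![5, 10, 11, 13], ![6, 10, 11, 14], ![2, 10, 14, 15], ![7, 10, 11, 15],
      ![3, 11, 12, 13], ![3, 11, 14, 15], ![6, 12, 13, 14], ![4, 12, 14, 15], ![7, 12, 13, 15], ![5, 13, 14, 15]]) : Fin 24 → (Fin 4 → Fin 16))
    ((![
      ![![none, none], ![none, none], ![none, none], ![none, none]],
      ![![none, some (0, [0, 1])], ![none, some (1, [1, 2])], ![none, none], ![none, none]],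
      ![![none, some (2, [0, 1])], ![some (1, [1]), none], ![none, none], ![none, none]],
      ![![none, some (3, [0, 1])], ![none, some (4, [1, 2])], ![none, none], ![none, none]],
      ![![none, some (5, [0, 1])], ![some (4, [1]), none], ![none, none], ![none, none]],
      ![![none, some (6, [0, 1])], ![none, some (7, [1, 2])], ![none, none], ![none, none]],
      ![![none, some (8, [0, 1])], ![some (7, [1]), none], ![none, none], ![none, none]],
      ![![some (0, [0]), none], ![none, some (9, [1, 2])], ![none, none], ![none, none]],
      ![![some (2, [0]), none], ![some (9, [1]), none], ![none, none], ![none, none]],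
      ![![some (3, [0]), none], ![none, some (10, [1, 2])], ![none, none], ![none, none]],
      ![![some (5, [0]), none], ![some (10, [1]), none], ![none, none], ![none, none]],
      ![![some (6, [0]), none], ![none, some (11, [1, 2])], ![none, none], ![none, none]],
      ![![some (8, [0]), none], ![some (11, [1]), none], ![none, none], ![none, none]],
      ![![none, none], ![none, none], ![none, none], ![none, none]],
      ![![none, some (12, [0, 1])], ![none, some (13, [1, 2])], ![none, none], ![none, none]],
      ![![none, some (14, [0, 1])], ![some (13, [1]), none], ![none, none], ![none, none]],
      ![![none, some (15, [0, 1])], ![none, some (16, [1, 2])], ![none, none], ![none, none]],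
      ![![none, some (17, [0, 1])], ![some (16, [1]), none], ![none, none], ![none, none]],
      ![![some (12, [0]), none], ![none, some (18, [1, 2])], ![none, none], ![none, none]],
      ![![some (14, [0]), none], ![some (18, [1]), none], ![none, none], ![none, none]],
      ![![some (15, [0]), none], ![none, some (19, [1, 2])], ![none, none], ![none, none]],
      ![![some (17, [0]), none], ![some (19, [1]), none], ![none, none], ![none, none]],
      ![![none, none], ![none, none], ![none, none], ![none, none]],
      ![![none, some (20, [0, 1])], ![none, some (21, [1, 2])], ![none, none], ![none, none]],
      ![![none, some (22, [0, 1])], ![some (21, [1]), none], ![none, none], ![none, none]],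
      ![![some (20, [0]), none], ![none, some (23, [1, 2])], ![none, none], ![none, none]],
      ![![some (22, [0]), none], ![some (23, [1]), none], ![none, none], ![none, none]],
      ![![none, none], ![none, none], ![none, none], ![none, none]]]) : Fin 28 → Fin 4 → Fin 2 → Option (Fin 24 × List (Fin 3)))
    (by decide +kernel) (by decide +kernel) (by decide +kernel)
  exact (congrArg (fun f : (Fin 8 ⊕ Fin 8 → ℝ) [⋀^Fin 4]→L[ℝ] ℂ => f u) h0).trans rfl

/-- **The `θ²`-table `tkcTheta22` is flat along the raising operator `N_3 = tkcRaise (ksForm 3)`** (certificate: 24 reference words,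
48 live terms; kernel-checked). [cite: vanGeemenVerra2003QuaternionicPryms, Cor. 6.5] -/
theorem tkc_flat_theta_raise_3 (u : Fin 4 → (Fin 8 ⊕ Fin 8 → ℝ)) :
    ∑ m, tkcTheta22 (Function.update u m (tkcRaise (tkcRaiseMat 3) (u m))) = 0 := by
  rw [tkcTheta22_eq, tkcTable_eq,
    tkc_slotSum_table_cols tkcFrame tkcVec tkc_sum_smulRight_frame_vec (tkcRaise (tkcRaiseMat 3))
      tkcThetaWord (fun _ => 1) (tkcRaiseCol 3) (tkcRaiseVal 3) (tkc_raise_frame_vec_eq 3) u]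
  have h0 := tkc_cert_sum_eq_zero (𝕜 := ℝ) (fun a => (tkcFrame a).smulRight (1 : ℂ))
    (ContinuousAlternatingMap.constOfIsEmpty ℝ (Fin 8 ⊕ Fin 8 → ℝ) (Fin 0) (1 : ℂ))
    (fun t j s => (fun _ : Fin 28 => (1 : ℤ)) t * tkcRaiseVal 3 s (tkcThetaWord t j))
    (fun t j s => Function.update (tkcThetaWord t) j (tkcRaiseCol 3 s (tkcThetaWord t j)))
    ((![
      ![1, 8, 9, 10], ![0, 8, 9, 11], ![3, 8, 10, 11], ![4, 8, 10, 12], ![0, 8, 12, 14], ![5, 8, 10, 13],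
      ![0, 8, 13, 15], ![6, 8, 10, 14], ![7, 8, 10, 15], ![2, 9, 10, 11], ![4, 9, 11, 12], ![1, 9, 12, 14],
      ![5, 9, 11, 13], ![1, 9, 13, 15], ![6, 9, 11, 14], ![7, 9, 11, 15], ![2, 10, 12, 14], ![2, 10, 13, 15],
      ![3, 11, 12, 14], ![3, 11, 13, 15], ![5, 12, 13, 14], ![4, 12, 13, 15], ![7, 12, 14, 15], ![6, 13, 14, 15]]) : Fin 24 → (Fin 4 → Fin 16))
    ((![
      ![![none, some (0, [0, 1, 2])], ![none, some (1, [1, 2])], ![none, none], ![none, none]],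
      ![![none, none], ![none, none], ![none, none], ![none, none]],
      ![![none, some (2, [0, 1])], ![some (1, [1]), none], ![none, none], ![none, none]],
      ![![none, some (3, [0, 1])], ![none, some (4, [1, 2])], ![none, none], ![none, none]],
      ![![none, some (5, [0, 1])], ![none, some (6, [1, 2])], ![none, none], ![none, none]],
      ![![none, some (7, [0, 1])], ![some (4, [1]), none], ![none, none], ![none, none]],
      ![![none, some (8, [0, 1])], ![some (6, [1]), none], ![none, none], ![none, none]],
      ![![none, some (9, [0, 1, 2])], ![some (0, []), none], ![none, none], ![none, none]],
      ![![none, none], ![none, none], ![none, none], ![none, none]],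
      ![![none, some (10, [0, 1])], ![none, some (11, [1, 2])], ![none, none], ![none, none]],
      ![![none, some (12, [0, 1])], ![none, some (13, [1, 2])], ![none, none], ![none, none]],
      ![![none, some (14, [0, 1])], ![some (11, [1]), none], ![none, none], ![none, none]],
      ![![none, some (15, [0, 1])], ![some (13, [1]), none], ![none, none], ![none, none]],
      ![![some (2, [0]), none], ![some (9, []), none], ![none, none], ![none, none]],
      ![![some (3, [0]), none], ![none, some (16, [1, 2])], ![none, none], ![none, none]],
      ![![some (5, [0]), none], ![none, some (17, [1, 2])], ![none, none], ![none, none]],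
      ![![some (7, [0]), none], ![some (16, [1]), none], ![none, none], ![none, none]],
      ![![some (8, [0]), none], ![some (17, [1]), none], ![none, none], ![none, none]],
      ![![some (10, [0]), none], ![none, some (18, [1, 2])], ![none, none], ![none, none]],
      ![![some (12, [0]), none], ![none, some (19, [1, 2])], ![none, none], ![none, none]],
      ![![some (14, [0]), none], ![some (18, [1]), none], ![none, none], ![none, none]],
      ![![some (15, [0]), none], ![some (19, [1]), none], ![none, none], ![none, none]],
      ![![none, some (20, [0, 1, 2])], ![none, some (21, [1, 2])], ![none, none], ![none, none]],
      ![![none, none], ![none, none], ![none, none], ![none, none]],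
      ![![none, some (22, [0, 1])], ![some (21, [1]), none], ![none, none], ![none, none]],
      ![![none, some (23, [0, 1, 2])], ![some (20, []), none], ![none, none], ![none, none]],
      ![![none, none], ![none, none], ![none, none], ![none, none]],
      ![![some (22, [0]), none], ![some (23, []), none], ![none, none], ![none, none]]]) : Fin 28 → Fin 4 → Fin 2 → Option (Fin 24 × List (Fin 3)))
    (by decide +kernel) (by decide +kernel) (by decide +kernel)
  exact (congrArg (fun f : (Fin 8 ⊕ Fin 8 → ℝ) [⋀^Fin 4]→L[ℝ] ℂ => f u) h0).trans rfl

/-- **The `θ²`-table `tkcTheta22` is flat along the raising operator `N_4 = tkcRaise (ksForm 4)`** (certificate: 24 reference words,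
48 live terms; kernel-checked). [cite: vanGeemenVerra2003QuaternionicPryms, Cor. 6.5] -/
theorem tkc_flat_theta_raise_4 (u : Fin 4 → (Fin 8 ⊕ Fin 8 → ℝ)) :
    ∑ m, tkcTheta22 (Function.update u m (tkcRaise (tkcRaiseMat 4) (u m))) = 0 := by
  rw [tkcTheta22_eq, tkcTable_eq,
    tkc_slotSum_table_cols tkcFrame tkcVec tkc_sum_smulRight_frame_vec (tkcRaise (tkcRaiseMat 4))
      tkcThetaWord (fun _ => 1) (tkcRaiseCol 4) (tkcRaiseVal 4) (tkc_raise_frame_vec_eq 4) u]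
  have h0 := tkc_cert_sum_eq_zero (𝕜 := ℝ) (fun a => (tkcFrame a).smulRight (1 : ℂ))
    (ContinuousAlternatingMap.constOfIsEmpty ℝ (Fin 8 ⊕ Fin 8 → ℝ) (Fin 0) (1 : ℂ))
    (fun t j s => (fun _ : Fin 28 => (1 : ℤ)) t * tkcRaiseVal 4 s (tkcThetaWord t j))
    (fun t j s => Function.update (tkcThetaWord t) j (tkcRaiseCol 4 s (tkcThetaWord t j)))
    ((![
      ![1, 8, 9, 12], ![0, 8, 9, 13], ![2, 8, 10, 12], ![0, 8, 10, 14], ![3, 8, 11, 12], ![0, 8, 11, 15],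
      ![5, 8, 12, 13], ![6, 8, 12, 14], ![7, 8, 12, 15], ![2, 9, 10, 13], ![1, 9, 10, 14], ![3, 9, 11, 13],
      ![1, 9, 11, 15], ![4, 9, 12, 13], ![6, 9, 13, 14], ![7, 9, 13, 15], ![3, 10, 11, 14], ![2, 10, 11, 15],
      ![4, 10, 12, 14], ![5, 10, 13, 14], ![7, 10, 14, 15], ![4, 11, 12, 15], ![5, 11, 13, 15], ![6, 11, 14, 15]]) : Fin 24 → (Fin 4 → Fin 16))
    ((![
      ![![none, some (0, [0, 1, 2])], ![none, some (1, [1, 2])], ![none, none], ![none, none]],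
      ![![none, some (2, [0, 1, 2])], ![none, some (3, [1, 2])], ![none, none], ![none, none]],
      ![![none, some (4, [0, 1, 2])], ![none, some (5, [1, 2])], ![none, none], ![none, none]],
      ![![none, none], ![none, none], ![none, none], ![none, none]],
      ![![none, some (6, [0, 1])], ![some (1, [1]), none], ![none, none], ![none, none]],
      ![![none, some (7, [0, 1])], ![some (3, [1]), none], ![none, none], ![none, none]],
      ![![none, some (8, [0, 1])], ![some (5, [1]), none], ![none, none], ![none, none]],
      ![![none, some (9, [0, 1, 2])], ![none, some (10, [1, 2])], ![none, none], ![none, none]],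
      ![![none, some (11, [0, 1, 2])], ![none, some (12, [1, 2])], ![none, none], ![none, none]],
      ![![none, some (13, [0, 1, 2])], ![some (0, []), none], ![none, none], ![none, none]],
      ![![none, none], ![none, none], ![none, none], ![none, none]],
      ![![none, some (14, [0, 1])], ![some (10, [1]), none], ![none, none], ![none, none]],
      ![![none, some (15, [0, 1])], ![some (12, [1]), none], ![none, none], ![none, none]],
      ![![none, some (16, [0, 1, 2])], ![none, some (17, [1, 2])], ![none, none], ![none, none]],
      ![![none, some (18, [0, 1, 2])], ![some (2, []), none], ![none, none], ![none, none]],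
      ![![none, some (19, [0, 1, 2])], ![some (9, []), none], ![none, none], ![none, none]],
      ![![none, none], ![none, none], ![none, none], ![none, none]],
      ![![none, some (20, [0, 1])], ![some (17, [1]), none], ![none, none], ![none, none]],
      ![![none, some (21, [0, 1, 2])], ![some (4, []), none], ![none, none], ![none, none]],
      ![![none, some (22, [0, 1, 2])], ![some (11, []), none], ![none, none], ![none, none]],
      ![![none, some (23, [0, 1, 2])], ![some (16, []), none], ![none, none], ![none, none]],
      ![![none, none], ![none, none], ![none, none], ![none, none]],
      ![![some (6, [0]), none], ![some (13, []), none], ![none, none], ![none, none]],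
      ![![some (7, [0]), none], ![some (18, []), none], ![none, none], ![none, none]],
      ![![some (8, [0]), none], ![some (21, []), none], ![none, none], ![none, none]],
      ![![some (14, [0]), none], ![some (19, []), none], ![none, none], ![none, none]],
      ![![some (15, [0]), none], ![some (22, []), none], ![none, none], ![none, none]],
      ![![some (20, [0]), none], ![some (23, []), none], ![none, none], ![none, none]]]) : Fin 28 → Fin 4 → Fin 2 → Option (Fin 24 × List (Fin 3)))
    (by decide +kernel) (by decide +kernel) (by decide +kernel)
  exact (congrArg (fun f : (Fin 8 ⊕ Fin 8 → ℝ) [⋀^Fin 4]→L[ℝ] ℂ => f u) h0).trans rfl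

end Summit.HodgeConjecture.HodgeConjecture.Theorems

end
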